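import Literature.AlgebraicGeometry.Resolution.RegularLocalRingsJacobian
import Literature.AlgebraicGeometry.Motives.ProjectiveSpaceDehomogenize
import Literature.AlgebraicGeometry.Motives.VarietiesRegularProofs
import Literature.AlgebraicGeometry.Motives.GoodReductionSpecialFibreProofs
import Mathlib.RingTheory.MvPolynomial.EulerIdentity
import HarnessLib

/-!
# The Jacobian criterion for smooth projective hypersurfaces over any field

`Literature/AlgebraicGeometry/HodgeTheory/HypersurfaceJacobian` discharges the named fact
`Hartshorne1977_smoothHypersurface_jacobian` over `ℂ`. This file records the same argument over
an ARBITRARY field `k`, with the hypotheses in the shape of the binders of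
`Literature.AlgebraicGeometry.Motives.Mboro2018_chowTwo_cubic` (`Motives/LinearSubspacesGenerateChow`):
for a smooth projective `n`-fold `Y` over `k` (`IsSmoothProjective n Y`), an irreducible form `F`
of degree `d` on `ℙⁿ⁺¹_k` and a closed `k`-immersion `ι : Y ↪ ℙⁿ⁺¹_k` with image `V₊(F)`, **the
gradient of `F` vanishes at no non-zero `k`-rational zero of `F`**
(`IsSmoothProjective.exists_eval_pderiv_ne_zero`). Reducedness of `Y`, part of the hypersurface
hypothesis of the `ℂ`-version, is automatic here (`isReduced_of_smoothOfRelativeDimension`,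
Stacks 056T).

## Proof (Hartshorne, *Algebraic Geometry*, I Thm. 5.1, I Ex. 5.8, II Prop. 2.5, III Ex. 10.0.3)

Suppose `F(z) = 0`, `z ≠ 0` and `∇F(z) = 0`; rescale so that `zᵢ = 1`. Dehomogenise:
`f = F(xᵢ := 1)`, `a = (z_{i.succAbove j})ⱼ`; then `f(a) = 0`, `∇f(a) = 0`, `f ≠ 0`, and `f` is
irreducible or a unit. On the chart `D₊(Xᵢ) = Spec A`, `A = (k[X]_{Xᵢ})₀ ≅ k[y]`, the pull-back of
`ι` is a closed immersion `W ≅ Spec A/I` with image `V(F/Xᵢᵈ)`; `W` is reduced, so `I` is radical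
and `I = (F/Xᵢᵈ)`. Smoothness makes `𝒪_{Y,y}` regular for all `y`
(`isRegularLocalRing_stalk_of_smoothOfRelativeDimension`), hence `(k[y]/(f))_{𝔞_a}` is regular;
but `0 ≠ f ∈ 𝔞_a²` (Taylor), so it is not
(`Resolution.not_isRegularLocalRing_localization_of_pderiv_eval_eq_zero`, Matsumura 14.2) —
contradiction.

## References

* R. Hartshorne, *Algebraic Geometry* (1977), I Thm. 5.1, Ex. 5.8; II Prop. 2.5, Example 3.2.6,
  Ex. 3.11; III Example 10.0.3. [Hartshorne1977]
* The Stacks Project, Tag 056T. [StacksProject]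
-/

noncomputable section

open AlgebraicGeometry CategoryTheory CategoryTheory.Limits MvPolynomial HomogeneousLocalization

universe u

namespace Literature.AlgebraicGeometry.Motives

/-! ### Transport of local rings along ring isomorphisms -/

section Transport

/-- If `e : S ≃+* T` and `𝔮 ⊂ T` is prime then `S_{e⁻¹𝔮} ≅ T_𝔮`; in particular regularity
transports. [folklore] -/
private theorem isRegularLocalRing_localization_comap_ringEquiv' {S T : Type*} [CommRing S] [CommRing T]
    (e : S ≃+* T) (Q : Ideal T) [Q.IsPrime] [IsRegularLocalRing (Localization.AtPrime Q)] :
    IsRegularLocalRing (Localization.AtPrime (Q.comap (e : S →+* T))) := by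
  have H : Submonoid.map (e : S →+* T).toMonoidHom (Q.comap (e : S →+* T)).primeCompl =
      Q.primeCompl := by
    ext x
    simp only [Submonoid.mem_map, RingHom.toMonoidHom_eq_coe, MonoidHom.coe_coe, RingHom.coe_coe]
    constructor
    · rintro ⟨s, hs, rfl⟩
      exact hs
    · intro hx
      refine ⟨e.symm x, ?_, by simp⟩
      change e.symm x ∉ Q.comap (e : S →+* T)
      rw [Ideal.mem_comap]
      simpa using hx
  exact IsRegularLocalRing.of_ringEquiv
    (IsLocalization.ringEquivOfRingEquiv (Localization.AtPrime (Q.comap (e : S →+* T)))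
      (Localization.AtPrime Q) e H).symm

end Transport

/-- **Jacobian criterion for smooth projective hypersurfaces over a field**: if `Y` is a smooth
projective `n`-fold over `k`, `F` an irreducible homogeneous form of degree `d` on `ℙⁿ⁺¹_k` and
`ι : Y ↪ ℙⁿ⁺¹_k` a closed `k`-immersion with image `V₊(F)`, then at every non-zero zero
`z ∈ kⁿ⁺²` of `F` some partial derivative `∂F/∂X_j(z)` is non-zero.
[cite: Hartshorne1977, I Thm. 5.1 and Ex. 5.8; III Example 10.0.3] [cite: StacksProject, Tag 056T] -/
theorem IsSmoothProjective.exists_eval_pderiv_ne_zero {k : Type u} [Field k] {n d : ℕ}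
    {Y : SchemeOver k} {F : MvPolynomial (Fin (n + 2)) k} (hY : IsSmoothProjective n Y)
    (hF : F.IsHomogeneous d) (hirr : Irreducible F) (ι : Y ⟶ projectiveSpace (n + 1) k)
    [hιci : IsClosedImmersion ι.left]
    (hrange : letI := MvPolynomial.gradedAlgebra (σ := Fin (n + 2)) (R := k)
      Set.range ι.left.base =
        ProjectiveSpectrum.zeroLocus (MvPolynomial.homogeneousSubmodule (Fin (n + 2)) k) {F})
    {z : Fin (n + 2) → k} (hz : z ≠ 0) (hFz : MvPolynomial.eval z F = 0) :
    ∃ j, MvPolynomial.eval z (MvPolynomial.pderiv j F) ≠ 0 := by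
  by_contra! hgrad
  classical
  -- the grading of `k[X₀, …, X_{n+1}]` and the `k`-algebra structure on `(k[X]_{Xᵢ})₀`, as local
  -- instances (as in `projectiveSpace`, `Motives/VarietiesProjectiveSpaceProofs`)
  letI inst𝒜 := MvPolynomial.gradedAlgebra (σ := Fin (n + 2)) (R := k)
  -- ### Step 0: normalise `zᵢ = 1`
  obtain ⟨i, hi⟩ := Function.ne_iff.mp hz
  letI instAlg := ProjBaseChange.algebraBase
    (MvPolynomial.homogeneousSubmodule (Fin (n + 2)) k)
    (Submonoid.powers (X i : MvPolynomial (Fin (n + 2)) k))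
  set w : Fin (n + 2) → k := fun s => (z i)⁻¹ * z s with hw
  have hwi : w i = 1 := inv_mul_cancel₀ hi
  have hFw : eval w F = 0 := by
    have := ProjectiveSpace.isHomogeneous_aeval_const_mul hF ((z i)⁻¹) z
    simp only [aeval_eq_eval] at this
    rw [hFz, mul_zero] at this
    exact this
  have hgradw : ∀ j, eval w (pderiv j F) = 0 := by
    intro j
    have := ProjectiveSpace.isHomogeneous_aeval_const_mul (hF.pderiv (i := j)) ((z i)⁻¹) z
    simp only [aeval_eq_eval] at this
    rw [hgrad j, mul_zero] at this
    exact this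
  -- ### Step 1: dehomogenise
  set f : MvPolynomial (Fin (n + 1)) k := ProjectiveSpace.dehomogenize k i F with hfdef
  set a : Fin (n + 1) → k := fun j => w (i.succAbove j) with ha
  have hfa : eval a f = 0 := by
    rw [hfdef, ProjectiveSpace.eval_dehomogenize i w hwi]; exact hFw
  have hgrada : ∀ j, eval a (pderiv j f) = 0 := by
    intro j
    rw [hfdef, ProjectiveSpace.pderiv_dehomogenize,
      ProjectiveSpace.eval_dehomogenize i w hwi]
    exact hgradw _
  have hfirr : Irreducible f ∨ IsUnit f :=
    ProjectiveSpace.irreducible_or_isUnit_dehomogenize i hF hirr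
  have hf0 : f ≠ 0 := by
    rcases hfirr with h | h
    · exact h.ne_zero
    · exact h.ne_zero
  -- `d > 0`
  have hF0 : F ≠ 0 := hirr.ne_zero
  have hd : 0 < d := by
    by_contra hd0
    obtain rfl : d = 0 := by omega
    have h1 : F.totalDegree = 0 := hF.totalDegree hF0
    rw [totalDegree_eq_zero_iff_eq_C] at h1
    apply hirr.not_isUnit
    rw [h1]
    refine IsUnit.map C (isUnit_iff_ne_zero.mpr ?_)
    intro hc
    apply hF0
    rw [h1, hc, map_zero]
  -- ### Step 2: the chart ring `A = (k[X]_{Xᵢ})₀ ≅ k[y]` and the equation `fA = F/Xᵢᵈ`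
  have hXi := ProjectiveSpace.X_mem (R := k) i
  have hFmem : F ∈ MvPolynomial.homogeneousSubmodule (Fin (n + 2)) k d :=
    (mem_homogeneousSubmodule d F).mpr hF
  set fA : Away (MvPolynomial.homogeneousSubmodule (Fin (n + 2)) k) (X i) :=
    Away.isLocalizationElem hXi hFmem with hfA
  let e₀ := ProjectiveSpace.chartAlgEquiv k i
    -- `: Away 𝓐 (X i) ≃ₐ[k] MvPolynomial (Fin (n + 1)) k`
  have he₀fA : e₀ fA = f := by
    change ProjectiveSpace.ofChartRingHom k i _ = _
    rw [hfA, Away.isLocalizationElem, ProjectiveSpace.ofChartRingHom_mk, map_pow, pow_one]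
  have he₀symm : e₀.symm f = fA := by rw [← he₀fA, AlgEquiv.symm_apply_apply]
  -- `fA` is prime or a unit, so `(fA)` is a radical ideal
  have hspan_rad : (Ideal.span {fA}).IsRadical := by
    rcases hfirr with h | h
    · have hp : Prime fA := by
        rw [← MulEquiv.prime_iff e₀, he₀fA]
        exact h.prime
      exact ((Ideal.span_singleton_prime hp.ne_zero).mpr hp).isRadical
    · have hu : IsUnit fA := by
        rw [← he₀symm]
        exact h.map e₀.symm
      rw [Ideal.span_singleton_eq_top.mpr hu]
      exact le_top
  -- ### Step 3: the closed immersion `ι : Y → ℙ^{n+1}` and its pull-back to the chart `D₊(Xᵢ)`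
  haveI hred : IsReduced Y.left := by
    haveI := hY.smoothOfRelativeDimension
    exact isReduced_of_smoothOfRelativeDimension Y.hom n
  set c : Spec (CommRingCat.of (Away (MvPolynomial.homogeneousSubmodule (Fin (n + 2)) k) (X i))) ⟶
      (projectiveSpace (n + 1) k).left :=
    Proj.awayι (MvPolynomial.homogeneousSubmodule (Fin (n + 2)) k) (X i) hXi one_pos with hc
  haveI : IsOpenImmersion c :=
    inferInstanceAs (IsOpenImmersion (Proj.awayι _ (X i) hXi one_pos))
  haveI : IsOpenImmersion (pullback.fst ι.left c) := inferInstance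
  haveI : IsClosedImmersion (pullback.snd ι.left c) := inferInstance
  obtain ⟨I, e, hp₂⟩ := (IsClosedImmersion.Spec_iff (f := pullback.snd ι.left c)).mp inferInstance
  -- the image of `W → Spec A` is `V(F/Xᵢᵈ)` …
  have hrange₂ : Set.range (pullback.snd ι.left c).base =
      PrimeSpectrum.zeroLocus {fA} := by
    have hr : Set.range (pullback.snd ι.left c).base = c.base ⁻¹' Set.range ι.left.base :=
      Scheme.Pullback.range_snd ι.left c
    rw [hr, hrange]
    ext q
    have key := Proj.awayι_preimage_basicOpen (MvPolynomial.homogeneousSubmodule (Fin (n + 2)) k)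
      hXi one_pos hFmem hd
    have k2 : c.base q ∈ Proj.basicOpen _ F ↔ q ∈ PrimeSpectrum.basicOpen fA :=
      SetLike.ext_iff.mp key q
    have k3 : F ∉ (c.base q : ProjectiveSpectrum (MvPolynomial.homogeneousSubmodule
        (Fin (n + 2)) k)).asHomogeneousIdeal ↔ fA ∉ q.asIdeal :=
      ((Proj.mem_basicOpen _ F _).symm.trans k2).trans (PrimeSpectrum.mem_basicOpen fA q)
    have k4 := ProjectiveSpectrum.mem_zeroLocus (MvPolynomial.homogeneousSubmodule (Fin (n + 2)) k)
      (c.base q) ({F} : Set (MvPolynomial (Fin (n + 2)) k))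
    have k5 := PrimeSpectrum.mem_zeroLocus q ({fA} : Set _)
    refine (k4.trans ?_).trans k5.symm
    rw [Set.singleton_subset_iff, Set.singleton_subset_iff, SetLike.mem_coe, SetLike.mem_coe]
    exact not_iff_not.mp k3
  -- … and it is `V(I)`
  have hrangeI : Set.range (pullback.snd ι.left c).base = PrimeSpectrum.zeroLocus (I : Set _) := by
    rw [hp₂]
    simp only [Scheme.Hom.comp_base, TopCat.hom_comp, ContinuousMap.coe_comp, Set.range_comp]
    have hsurj : Function.Surjective e.hom.base := e.hom.homeomorph.surjective
    rw [Set.range_eq_univ.mpr hsurj, Set.image_univ]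
    change Set.range (PrimeSpectrum.comap (Ideal.Quotient.mk I)) = _
    rw [range_comap_of_surjective _ _ Ideal.Quotient.mk_surjective, Ideal.mk_ker]
  have hzl : PrimeSpectrum.zeroLocus (I : Set _) = PrimeSpectrum.zeroLocus {fA} :=
    hrangeI.symm.trans hrange₂
  -- `I` is radical: `W` is reduced, being open in the reduced scheme `Y`
  haveI := hred
  have hIrad : I.IsRadical := by
    rw [Ideal.isRadical_iff_quotient_reduced]
    haveI : IsReduced (pullback ι.left c) := isReduced_of_isOpenImmersion (pullback.fst ι.left c)
    have : IsReduced (Spec (CommRingCat.of (_ ⧸ I))) := isReduced_of_isOpenImmersion e.inv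
    exact (affine_isReduced_iff _).mp this
  have hI : I = Ideal.span {fA} := by
    have h1 := congrArg PrimeSpectrum.vanishingIdeal hzl
    rwa [PrimeSpectrum.vanishingIdeal_zeroLocus_eq_radical, ← PrimeSpectrum.zeroLocus_span {fA},
      PrimeSpectrum.vanishingIdeal_zeroLocus_eq_radical, hIrad.radical, hspan_rad.radical] at h1
  -- ### Step 4: the point of `W` over `[z]`
  haveI hQ₀ : (RingHom.ker (eval a : MvPolynomial (Fin (n + 1)) k →+* k)).IsPrime :=
    RingHom.ker_isPrime _
  let 𝔭 : PrimeSpectrum (Away (MvPolynomial.homogeneousSubmodule (Fin (n + 2)) k) (X i)) :=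
    ⟨(RingHom.ker (eval a)).comap (e₀ : _ →+* MvPolynomial (Fin (n + 1)) k),
      Ideal.comap_isPrime _ _⟩
  have h𝔭mem : 𝔭 ∈ Set.range (pullback.snd ι.left c).base := by
    rw [hrange₂]
    change ({fA} : Set _) ⊆ _
    rw [Set.singleton_subset_iff]
    change e₀ fA ∈ RingHom.ker (eval a)
    rw [he₀fA, RingHom.mem_ker]
    exact hfa
  obtain ⟨wpt, hwpt⟩ := h𝔭mem
  -- ### Step 5: the local ring of `Y` at the point is regular, hence so is `(A/I)_𝔮`
  haveI := hY.smoothOfRelativeDimension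
  haveI hreg1 : IsRegularLocalRing (Y.left.presheaf.stalk ((pullback.fst ι.left c).base wpt)) :=
    isRegularLocalRing_stalk_of_smoothOfRelativeDimension Y.hom n _
  haveI hreg2 : IsRegularLocalRing ((pullback ι.left c).presheaf.stalk wpt) :=
    IsRegularLocalRing.of_ringEquiv
      (asIso ((pullback.fst ι.left c).stalkMap wpt)).commRingCatIsoToRingEquiv
  set q := e.hom.base wpt with hq
  haveI hreg3 : IsRegularLocalRing ((Spec (CommRingCat.of (_ ⧸ I))).presheaf.stalk q) :=
    IsRegularLocalRing.of_ringEquiv (asIso (e.hom.stalkMap wpt)).commRingCatIsoToRingEquiv.symm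
  haveI hreg3' : IsRegularLocalRing ((structurePresheafInCommRingCat _).stalk q) := hreg3
  haveI hreg4 : IsRegularLocalRing (Localization.AtPrime q.asIdeal) :=
    IsRegularLocalRing.of_ringEquiv (StructureSheaf.stalkIso _ q).toRingEquiv.symm
  -- ### Step 6: `𝔮` lies over `𝔞_a`
  have hqcomap : q.asIdeal.comap (Ideal.Quotient.mk I) = 𝔭.asIdeal := by
    have h1 : (pullback.snd ι.left c).base wpt =
        (Spec.map (CommRingCat.ofHom (Ideal.Quotient.mk I))).base q := by
      rw [hq, hp₂]
      rfl
    rw [hwpt] at h1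
    rw [h1]
    rfl
  -- ### Step 7: transport to `(k[y]/(f))_{𝔞_a}` and apply the criterion
  have hmapspan : Ideal.span {fA} =
      Ideal.map (e₀.symm.toRingEquiv : MvPolynomial (Fin (n + 1)) k →+* _) (Ideal.span {f}) := by
    rw [Ideal.map_span, Set.image_singleton]
    congr 2
    exact he₀symm.symm
  let E : (MvPolynomial (Fin (n + 1)) k ⧸ Ideal.span {f}) ≃+*
      (Away (MvPolynomial.homogeneousSubmodule (Fin (n + 2)) k) (X i) ⧸ I) :=
    (Ideal.quotientEquiv (Ideal.span {f}) (Ideal.span {fA}) e₀.symm.toRingEquiv hmapspan).trans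
      (Ideal.quotEquivOfEq hI.symm)
  have hreg5 := isRegularLocalRing_localization_comap_ringEquiv' E q.asIdeal
  have hcomap : (q.asIdeal.comap (E : _ →+* _)).comap (Ideal.Quotient.mk (Ideal.span {f})) =
      RingHom.ker (eval a) := by
    ext g
    rw [Ideal.mem_comap, Ideal.mem_comap, RingHom.coe_coe]
    have hE : E (Ideal.Quotient.mk _ g) = Ideal.Quotient.mk I (e₀.symm g) := by
      simp [E]
    rw [hE, ← Ideal.mem_comap, hqcomap]
    change e₀ (e₀.symm g) ∈ RingHom.ker (eval a) ↔ _
    rw [AlgEquiv.apply_symm_apply]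
  exact Resolution.not_isRegularLocalRing_localization_of_pderiv_eval_eq_zero a hf0 hfa hgrada _
    hcomap hreg5

end Literature.AlgebraicGeometry.Motives
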